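import Summits.KontsevichZagierPeriods.KontsevichZagierPeriods.Theorems.HermiteRigidityReductionRigidityPadeBoxIslandsAllWeights
import Summits.KontsevichZagierPeriods.KontsevichZagierPeriods.Theorems.HermiteRigidityReductionRigidityLineReduction
import Summits.KontsevichZagierPeriods.KontsevichZagierPeriods.Theorems.HermiteRigidityDilogRigidity
import Summits.KontsevichZagierPeriods.KontsevichZagierPeriods.Theorems.HermiteRigidityDilogRigidityCubeTwoSeriesLevel
import Literature.NumberTheory.DiophantineApproximation.DilogLandenLinearIndependence
import Summits.KontsevichZagierPeriods.KontsevichZagierPeriods.Theorems.HermiteRigidityReductionRigidityJoinProductNormalForm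
import Summits.KontsevichZagierPeriods.KontsevichZagierPeriods.Theorems.HermiteRigidityReductionRigidityJoinReflection
import Summits.KontsevichZagierPeriods.KontsevichZagierPeriods.Theorems.HermiteRigidityReductionRigidityJoinLandenScaled
import Summits.KontsevichZagierPeriods.KontsevichZagierPeriods.Theorems.HermiteRigidityReductionRigidityJoinValueNegLevel

/-!
# `ReductionRigidity` (stmt-KontsevichZagierPeriods-3407), line `Sketch`: THE LANDEN JOIN ISLAND — levels `q` and `1 − q`
# with products (`stub_landenJoinKernel`), unconditional-minus-Viola–Zudilin for every `q ≥ 9`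

Route `KontsevichZagierPeriods/HermiteRigidity`, crux `ReductionRigidity` (stmt-3407, summit-equivalent; skeleton
`Cruxes/ReductionRigidity/Lines/Sketch.lean` v7). Lead seat c6, cycle 2. The route's Padé box islands (c4/c5) live at ONE
level `ν`; the island complement begins with CROSS-LEVEL relations, the first of which is LANDEN's
`Li₂(1/q) + Li₂(1/(1−q)) = −½ log²(1 − 1/q)` (a landed move chain, `stub_boxLanden`). This file proves the first
TWO-LEVEL island: on the sector of the formal group generated by the box generators `[□ʲ, x^a/(ν − ∏x)^m]` (`j ≤ 2`) at
`ν = q` and at `ν = 1 − q` together with the product sector `[□², x^a y^b/((q−x)^m (q−y)^n)]`, the kernel form of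
Conjecture 1 holds as soon as `1, Li₁(1/q), Li₂(1/q), Li₂(1/(1−q))` are ℚ-linearly independent (`stub_landenJoinKernel`,
rigidity inlined) — and that is Viola–Zudilin's theorem for `q ≥ 9` (`landenJoinKernel_nine`, over the tree's named fact).
Reductions: `genReduction` at both levels (`levelNormalForm`), the weight-one reflection `p ↦ 1 − p` across levels
(`stub_joinReflection`), the product normal form in the formal period ring (`stub_joinProductNormalForm`), and Landen's
chain (`stub_joinLandenScaled`), which supplies both the value relation `2I₂ + 2I₂' + I_P = 0` (soundness) and the final
weight-two move.

References: M. Kontsevich, D. Zagier, *Periods* (2001), §1.2 [cite: KontsevichZagier2001, §1.2]; C. Viola, W. Zudilin,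
J. reine angew. Math. 736 (2018) [cite: ViolaZudilin2018, main theorem]; S. David, N. Hirata-Kohno, M. Kawashima (2020), §1
[cite: DavidHirataKohnoKawashima2020, §1]. No definitions are introduced.
-/

noncomputable section

open MeasureTheory Set MvPolynomial

namespace Summit.KontsevichZagierPeriods.HermiteRigidity.ReductionRigidity

open Literature.NumberTheory.Transcendental
open Literature.NumberTheory.Transcendental.KZ

/-! ## Small tools -/

/-- Generic normal form on the level-`ν` box sector of dimensions `≤ w` (c4's closure induction, extracted).
[cite: KontsevichZagier2001, §1.2] -/
theorem levelNormalForm {ν : ℚ} (hν : 1 < ν ∨ ν < 0) (w : ℕ) :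
    ∀ c ∈ AddSubgroup.closure
      {c | ∃ (j : ℕ) (r : IntegralRep j) (a : Fin j → ℕ) (m : ℕ), j ≤ w ∧ r.domain = cube j ∧
          EqOn r.integrand (fun p => (∏ l, p l ^ a l) / ((ν : ℝ) - ∏ l, p l) ^ m) (cube j) ∧ c = KZ.of r},
    ∃ (α : ℕ → ℚ) (s : (i : ℕ) → IntegralRep i),
      (∀ i, (s i).domain = cube i ∧ EqOn (s i).integrand (fun p => (α i : ℝ) / ((ν : ℝ) - ∏ l, p l)) (cube i)) ∧
      c - ∑ i ∈ Finset.range (w + 1), KZ.of (s i) ∈ KZ.relations := by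
  intro c hc
  induction hc using AddSubgroup.closure_induction with
  | mem x hx =>
    obtain ⟨j, r, a, m, hjw, hr, hri, rfl⟩ := hx
    exact genReduction hν j hjw m 1 a r hr fun p hp => by rw [hri hp]; push_cast; ring
  | zero => exact gnf_zero hν w
  | add x y _ _ hx hy => exact gnf_add hν hx hy
  | neg x _ hx => exact gnf_neg hν hx

/-- The constant `∫_{□⁰} 1/(ν − ∏∅) = 1/(ν − 1)`. [folklore] -/
theorem integral_cube_zero_level (ν : ℚ) :
    (∫ p in cube 0, 1 / ((ν : ℝ) - ∏ l, p l)) = 1 / ((ν : ℝ) - 1) := by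
  have hcube : cube 0 = (univ : Set (Fin 0 → ℝ)) := eq_univ_of_forall fun x i => i.elim0
  rw [hcube, setIntegral_univ, Measure.volume_pi_eq_dirac (default : Fin 0 → ℝ), integral_dirac]
  simp

/-- Three carriers of one additive family whose parameters sum to `0` add up to a relation.
[cite: KontsevichZagier2001, §1.2 rule (1)] -/
theorem three_carriers_zero {n : ℕ} {D : Set (Fin n → ℝ)} (f : ℚ → (Fin n → ℝ) → ℝ)
    (hf : ∀ β β' x, f (β + β') x = f β x + f β' x) (hf0 : ∀ x, f 0 x = 0)
    (hex : ∀ β : ℚ, ∃ s : IntegralRep n, s.domain = D ∧ EqOn s.integrand (f β) D)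
    {β₁ β₂ β₃ : ℚ} (hsum : β₁ + β₂ + β₃ = 0) {s₁ s₂ s₃ : IntegralRep n}
    (h₁ : s₁.domain = D) (h₁i : EqOn s₁.integrand (f β₁) D) (h₂ : s₂.domain = D) (h₂i : EqOn s₂.integrand (f β₂) D)
    (h₃ : s₃.domain = D) (h₃i : EqOn s₃.integrand (f β₃) D) :
    KZ.of s₁ + KZ.of s₂ + KZ.of s₃ ∈ KZ.relations := by
  obtain ⟨t, ht, hti⟩ := hex (β₁ + β₂)
  obtain ⟨u, hu, hui⟩ := hex (β₁ + β₂ + β₃)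
  have e₁ := carrier_add f hf h₁ h₁i h₂ h₂i ht hti
  have e₂ := carrier_add f hf ht hti h₃ h₃i hu hui
  have z : KZ.of u ∈ KZ.relations := carrier_zero f hf0 hu (by rw [hsum] at hui; exact hui)
  have : KZ.of s₁ + KZ.of s₂ + KZ.of s₃ = KZ.of u - (KZ.of u - KZ.of t - KZ.of s₃) - (KZ.of t - KZ.of s₁ - KZ.of s₂) := by
    abel
  rw [this]
  exact KZ.relations.sub_mem (KZ.relations.sub_mem z e₂) e₁

/-! ## The assembly -/

section Assembly

/-- **Registered LEAD stub `stub_landenJoinKernel` — THE LANDEN JOIN ISLAND**: for every integer `q ≥ 2`, IF the four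
numbers `1, ∫_□ dp/(q−p) (= Li₁(1/q)), ∫_□² dp/(q−pq) (= Li₂(1/q)), ∫_□² dp/((1−q)−pq) (= Li₂(1/(1−q)))` are
ℚ-linearly independent, THEN Conjecture 1 of Kontsevich–Zagier holds in kernel form on the sector generated by ALL box
generators `[□ʲ, x^a/(ν − ∏x)^m]`, `j ≤ 2`, at the TWO levels `ν = q` and `ν = 1 − q` AND the product sector
`[□², x^a y^b/((q−x)^m (q−y)^n)]` (values `ℚ⟨1, L₁, L₁², Li₂(1/q), Li₂(1/(1−q))⟩`, 4-dimensional by Landen): every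
`ℤ`-combination of value `0` is a chain of moves. The first CROSS-LEVEL island: its reductions are c4's `genReduction` at both
levels, the weight-one REFLECTION `[□¹, β/((1−q)−p)] ≡ −[□¹, β/(q−p)]` (`stub_joinReflection`), the product normal form
(`stub_joinProductNormalForm`, formal period ring) and LANDEN's chain `2[□²,1/(q−pq)] + 2[□²,1/((1−q)−pq)] + [□²,1/((q−p)(q−p'))]
∈ relations` (`stub_joinLandenScaled`), used twice — once through soundness for the value relation `2I₂ + 2I₂' + I_P = 0`,
once as the move that kills the surviving weight-two part. [cite: KontsevichZagier2001, §1.2] [cite: ViolaZudilin2018, main theorem] -/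
theorem stub_landenJoinKernel : ∀ (q : ℕ), 2 ≤ q →
    (∀ a b c d : ℚ, (a : ℝ) + b * (∫ p in cube 1, 1 / ((q : ℝ) - p 0)) +
        c * (∫ p in cube 2, 1 / ((q : ℝ) - p 0 * p 1)) + d * (∫ p in cube 2, 1 / ((1 - (q : ℝ)) - p 0 * p 1)) = 0 →
      a = 0 ∧ b = 0 ∧ c = 0 ∧ d = 0) →
    ∀ c ∈ AddSubgroup.closure
      ({c | ∃ (j : ℕ) (r : IntegralRep j) (a : Fin j → ℕ) (m : ℕ), j ≤ 2 ∧ r.domain = cube j ∧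
          EqOn r.integrand (fun p => (∏ l, p l ^ a l) / ((q : ℝ) - ∏ l, p l) ^ m) (cube j) ∧ c = KZ.of r} ∪
        {c | ∃ (j : ℕ) (r : IntegralRep j) (a : Fin j → ℕ) (m : ℕ), j ≤ 2 ∧ r.domain = cube j ∧
          EqOn r.integrand (fun p => (∏ l, p l ^ a l) / ((1 - (q : ℝ)) - ∏ l, p l) ^ m) (cube j) ∧ c = KZ.of r} ∪
        {c | ∃ (r : IntegralRep 2) (a b m n : ℕ), r.domain = cube 2 ∧
          EqOn r.integrand (fun p => p 0 ^ a * p 1 ^ b / (((q : ℝ) - p 0) ^ m * ((q : ℝ) - p 1) ^ n)) (cube 2) ∧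
          c = KZ.of r}),
      KZ.eval c = 0 → c ∈ KZ.relations := by
  intro q hq hrig c hc h0
  have hν : (1 : ℚ) < q ∨ (q : ℚ) < 0 := natLevel hq
  have hν' : (1 : ℚ) < (1 - q : ℚ) ∨ ((1 - q : ℚ)) < 0 := Or.inr (by
    have : (2 : ℚ) ≤ q := by exact_mod_cast hq
    linarith)
  have hqR : ((q : ℚ) : ℝ) = (q : ℝ) := by push_cast; ring
  have hq'R : (((1 - q : ℚ)) : ℝ) = 1 - (q : ℝ) := by push_cast; ring
  -- split `c` along the three generator families
  rw [AddSubgroup.closure_union, AddSubgroup.closure_union] at hc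
  obtain ⟨xy, hxy, z, hz, rfl⟩ := AddSubgroup.mem_sup.1 hc
  obtain ⟨x, hx, y, hy, rfl⟩ := AddSubgroup.mem_sup.1 hxy
  -- normal forms at the two levels and on the product sector
  obtain ⟨α, s, hs, hxs⟩ := levelNormalForm hν 2 x (by
    refine AddSubgroup.closure_mono (fun c hc => ?_) hx
    obtain ⟨j, r, a, m, hj, hr, hri, rfl⟩ := hc
    exact ⟨j, r, a, m, hj, hr, fun p hp => by rw [hri hp, hqR], rfl⟩)
  obtain ⟨α', t, ht, hyt⟩ := levelNormalForm hν' 2 y (by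
    refine AddSubgroup.closure_mono (fun c hc => ?_) hy
    obtain ⟨j, r, a, m, hj, hr, hri, rfl⟩ := hc
    exact ⟨j, r, a, m, hj, hr, fun p hp => by rw [hri hp, hq'R], rfl⟩)
  obtain ⟨αP, βP, εP, u₀, u₁, u₂, hu₀, hu₀i, hu₁, hu₁i, hu₂, hu₂i, hzu⟩ := stub_joinProductNormalForm q hq z hz
  -- the reflected level-(1−q) weight-one normal form, and a unit-parameter Landen triple (for the value relation)
  obtain ⟨t₁', ht₁', ht₁'i⟩ := exists_nf1 hq (-α' 1)
  have hrefl : KZ.of (t 1) - KZ.of t₁' ∈ KZ.relations :=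
    stub_joinReflection q hq (α' 1) (t 1) t₁' (ht 1).1 (fun p hp => by rw [(ht 1).2 hp, hq'R]; simp) ht₁' ht₁'i
  obtain ⟨L₂, hL₂, hL₂i⟩ := exists_nfRep (i := 2) hν (2 * 1)
  obtain ⟨L₂', hL₂', hL₂'i⟩ := exists_nfRep (i := 2) hν' (2 * 1)
  obtain ⟨LP, hLP, hLPi⟩ : ∃ r : IntegralRep 2, r.domain = cube 2 ∧
      EqOn r.integrand (fun p => ((1 : ℚ) : ℝ) / (((q : ℝ) - p 0) * ((q : ℝ) - p 1))) (cube 2) := by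
    have hden : ∀ x ∈ cube 2, aeval x (((C (q : ℚ) - X 0) * (C (q : ℚ) - X 1) : MvPolynomial (Fin 2) ℚ)) ≠ 0 := by
      intro x hx
      have h2 : (2 : ℝ) ≤ q := by exact_mod_cast hq
      simp only [map_sub, map_mul, aeval_C, aeval_X, eq_ratCast, Rat.cast_natCast]
      exact mul_ne_zero (by linarith [(hx 0).2]) (by linarith [(hx 1).2])
    exact ⟨(⟨C 1, _, hden⟩ : RFun 2).rep, rfl, fun x _ => by simp [RFun.rep_integrand, RFun.fn]⟩
  have hLanden1 := stub_joinLandenScaled q hq 1 L₂ L₂' LP hL₂ (fun p hp => by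
      rw [hL₂i hp]; beta_reduce; push_cast; rw [Fin.prod_univ_two])
    hL₂' (fun p hp => by rw [hL₂'i hp]; beta_reduce; push_cast; rw [Fin.prod_univ_two]) hLP hLPi
  -- VALUES
  have I0 : (∫ p in cube 0, 1 / (((q : ℚ) : ℝ) - ∏ l, p l)) = 1 / ((q : ℝ) - 1) := by
    rw [integral_cube_zero_level, hqR]
  have I0' : (∫ p in cube 0, 1 / ((((1 - q : ℚ)) : ℝ) - ∏ l, p l)) = 1 / (-(q : ℝ)) := by
    rw [integral_cube_zero_level, hq'R]; ring_nf
  have I1 : (∫ p in cube 1, 1 / (((q : ℚ) : ℝ) - ∏ l, p l)) = ∫ p in cube 1, 1 / ((q : ℝ) - p 0) :=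
    setIntegral_congr_fun measurableSet_cube fun p _ => by rw [hqR, Fin.prod_univ_one]
  have I2 : (∫ p in cube 2, 1 / (((q : ℚ) : ℝ) - ∏ l, p l)) = ∫ p in cube 2, 1 / ((q : ℝ) - p 0 * p 1) :=
    setIntegral_congr_fun measurableSet_cube fun p _ => by rw [hqR, Fin.prod_univ_two]
  have I2' : (∫ p in cube 2, 1 / ((((1 - q : ℚ)) : ℝ) - ∏ l, p l)) = ∫ p in cube 2, 1 / ((1 - (q : ℝ)) - p 0 * p 1) :=
    setIntegral_congr_fun measurableSet_cube fun p _ => by rw [hq'R, Fin.prod_univ_two]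
  -- value of a `[□¹, β/(N − p)]`, of a `[□¹, β/((1−q) − p)]` (via the reflection move), of constants and of `u₂`
  have eval_t1 : KZ.eval (KZ.of (t 1)) = -((α' 1 : ℚ) : ℝ) * ∫ p in cube 1, 1 / ((q : ℝ) - p 0) := by
    have h := eval_eq_zero_of_mem_relations hrefl
    rw [map_sub, sub_eq_zero] at h
    rw [h, eval_of, IntegralRep.value, ht₁', setIntegral_congr_fun measurableSet_cube ht₁'i, ← integral_const_mul]
    refine setIntegral_congr_fun measurableSet_cube fun p _ => ?_
    push_cast; ring
  have eval_u₁ : KZ.eval (KZ.of u₁) = (βP : ℝ) * ∫ p in cube 1, 1 / ((q : ℝ) - p 0) := by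
    rw [eval_of, IntegralRep.value, hu₁, setIntegral_congr_fun measurableSet_cube hu₁i, ← integral_const_mul]
    exact setIntegral_congr_fun measurableSet_cube fun p _ => by ring
  have eval_u₀ : KZ.eval (KZ.of u₀) = (αP : ℝ) := by
    rw [eval_of, IntegralRep.value, hu₀, setIntegral_congr_fun measurableSet_cube hu₀i]
    have hcube : cube 0 = (univ : Set (Fin 0 → ℝ)) := eq_univ_of_forall fun x i => i.elim0
    rw [hcube, setIntegral_univ, Measure.volume_pi_eq_dirac (default : Fin 0 → ℝ), integral_dirac]
  have eval_u₂ : KZ.eval (KZ.of u₂) = (εP : ℝ) * ∫ p in cube 2, 1 / (((q : ℝ) - p 0) * ((q : ℝ) - p 1)) := by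
    rw [eval_of, IntegralRep.value, hu₂, setIntegral_congr_fun measurableSet_cube hu₂i, ← integral_const_mul]
    exact setIntegral_congr_fun measurableSet_cube fun p _ => by ring
  have eval_LP : KZ.eval (KZ.of LP) = ∫ p in cube 2, 1 / (((q : ℝ) - p 0) * ((q : ℝ) - p 1)) := by
    rw [eval_of, IntegralRep.value, hLP, setIntegral_congr_fun measurableSet_cube hLPi]
    exact setIntegral_congr_fun measurableSet_cube fun p _ => by push_cast; ring
  -- the Landen VALUE relation: `2 I₂ + 2 I₂' + I_P = 0`
  have hLval : 2 * (∫ p in cube 2, 1 / ((q : ℝ) - p 0 * p 1)) + 2 * (∫ p in cube 2, 1 / ((1 - (q : ℝ)) - p 0 * p 1)) +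
      (∫ p in cube 2, 1 / (((q : ℝ) - p 0) * ((q : ℝ) - p 1))) = 0 := by
    have h := eval_eq_zero_of_mem_relations hLanden1
    rw [map_add, map_add, eval_nfRep hL₂ hL₂i, eval_nfRep hL₂' hL₂'i, eval_LP, I2, I2'] at h
    push_cast at h
    linarith
  -- the value of `c`
  have hsum3 : ∀ (v : (i : ℕ) → IntegralRep i), ∑ i ∈ Finset.range 3, KZ.of (v i) = KZ.of (v 0) + KZ.of (v 1) + KZ.of (v 2) := by
    intro v
    rw [Finset.sum_range_succ, Finset.sum_range_succ, Finset.sum_range_one]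
  rw [hsum3] at hxs hyt
  have hval : ((α 0 / ((q : ℚ) - 1) + α' 0 / (-(q : ℚ)) + αP : ℚ) : ℝ) +
      ((α 1 - α' 1 + βP : ℚ) : ℝ) * (∫ p in cube 1, 1 / ((q : ℝ) - p 0)) +
      ((α 2 - 2 * εP : ℚ) : ℝ) * (∫ p in cube 2, 1 / ((q : ℝ) - p 0 * p 1)) +
      ((α' 2 - 2 * εP : ℚ) : ℝ) * (∫ p in cube 2, 1 / ((1 - (q : ℝ)) - p 0 * p 1)) = 0 := by
    have ex := eval_eq_zero_of_mem_relations hxs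
    have ey := eval_eq_zero_of_mem_relations hyt
    have ez := eval_eq_zero_of_mem_relations hzu
    rw [map_sub, map_add, map_add, eval_nfRep (hs 0).1 (hs 0).2, eval_nfRep (hs 1).1 (hs 1).2,
      eval_nfRep (hs 2).1 (hs 2).2, I0, I1, I2] at ex
    rw [map_sub, map_add, map_add, eval_nfRep (ht 0).1 (ht 0).2, eval_t1, eval_nfRep (ht 2).1 (ht 2).2, I0', I2'] at ey
    rw [map_sub, map_add, map_add, eval_u₀, eval_u₁, eval_u₂] at ez
    rw [map_add, map_add] at h0
    have hq0 : (q : ℝ) ≠ 0 := by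
      have : (2 : ℝ) ≤ q := by exact_mod_cast hq
      linarith
    have hq1 : (q : ℝ) - 1 ≠ 0 := by
      have : (2 : ℝ) ≤ q := by exact_mod_cast hq
      linarith
    push_cast
    linear_combination h0 - ex - ey - ez - (εP : ℝ) * hLval
  obtain ⟨hA, hB, hC, hD⟩ := hrig _ _ _ _ hval
  -- CONCLUSION: every graded piece of the normal form is a relation
  have hC' : α 2 = 2 * εP := by linarith
  have hD' : α' 2 = 2 * εP := by linarith
  -- weight two: the scaled Landen triple
  have h2 : KZ.of (s 2) + KZ.of (t 2) + KZ.of u₂ ∈ KZ.relations :=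
    stub_joinLandenScaled q hq εP (s 2) (t 2) u₂ (hs 2).1 (fun p hp => by
        rw [(hs 2).2 hp, hC']; beta_reduce; push_cast; rw [Fin.prod_univ_two])
      (ht 2).1 (fun p hp => by rw [(ht 2).2 hp, hD']; beta_reduce; push_cast; rw [Fin.prod_univ_two]) hu₂ hu₂i
  -- weight one: three carriers of the family `[□¹, β/(q − p)]` with parameters summing to `0`
  have h1 : KZ.of (s 1) + KZ.of t₁' + KZ.of u₁ ∈ KZ.relations :=
    three_carriers_zero (D := cube 1) (fun β p => (β : ℝ) / ((q : ℝ) - p 0)) (fun β β' p => by push_cast; ring)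
      (fun p => by simp) (fun β => exists_nf1 hq β) (by linarith [hB] : α 1 + -α' 1 + βP = 0)
      (hs 1).1 (fun p hp => by rw [(hs 1).2 hp]; beta_reduce; push_cast; rw [Fin.prod_univ_one]) ht₁' ht₁'i hu₁ hu₁i
  -- weight zero: three constants summing to `0`
  have h0' : KZ.of (s 0) + KZ.of (t 0) + KZ.of u₀ ∈ KZ.relations := by
    refine three_carriers_zero (D := cube 0) (fun β _ => (β : ℝ)) (fun β β' p => by push_cast; ring)
      (fun p => by simp) (fun β => exists_nf0 β) (β₁ := α 0 / ((q : ℚ) - 1)) (β₂ := α' 0 / (-(q : ℚ)))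
      (β₃ := αP) hA (hs 0).1 (fun p hp => ?_) (ht 0).1 (fun p hp => ?_) hu₀ hu₀i
    · rw [(hs 0).2 hp]
      simp [Finset.univ_eq_empty]
    · rw [(ht 0).2 hp]
      simp [Finset.univ_eq_empty]
  have : x + y + z = (x - (KZ.of (s 0) + KZ.of (s 1) + KZ.of (s 2))) + (y - (KZ.of (t 0) + KZ.of (t 1) + KZ.of (t 2))) +
      (z - (KZ.of u₀ + KZ.of u₁ + KZ.of u₂)) + (KZ.of (t 1) - KZ.of t₁') +
      (KZ.of (s 2) + KZ.of (t 2) + KZ.of u₂) + (KZ.of (s 1) + KZ.of t₁' + KZ.of u₁) +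
      (KZ.of (s 0) + KZ.of (t 0) + KZ.of u₀) := by abel
  rw [this]
  refine KZ.relations.add_mem (KZ.relations.add_mem (KZ.relations.add_mem (KZ.relations.add_mem
    (KZ.relations.add_mem (KZ.relations.add_mem hxs hyt) hzu) hrefl) h2) h1) h0'

/-- **THE LANDEN JOIN ISLAND FOR EVERY `q ≥ 9`, over Viola–Zudilin 2018** (the tree's named fact
`ViolaZudilin2018_dilogLandenLinearIndependent`: `1, Li₁(1/q), Li₂(1/q), Li₂(1/(1−q))` are ℚ-independent for `q ≥ 9`):
Conjecture 1 in kernel form on the two-level sector `{q, 1−q}` with products. The three normal-form values are the series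
by `stub_cubeOneIntegralSeries`, `stub_cubeTwoIntegralSeriesLevel` (c5) and `stub_joinValueNegLevel`. A CONDITIONAL result
(named-fact hypothesis). [cite: ViolaZudilin2018, main theorem] [cite: KontsevichZagier2001, §1.2] -/
theorem landenJoinKernel_nine
    (hVZ : Literature.NumberTheory.DiophantineApproximation.ViolaZudilin2018_dilogLandenLinearIndependent) :
    ∀ (q : ℕ), 9 ≤ q → ∀ c ∈ AddSubgroup.closure
      ({c | ∃ (j : ℕ) (r : IntegralRep j) (a : Fin j → ℕ) (m : ℕ), j ≤ 2 ∧ r.domain = cube j ∧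
          EqOn r.integrand (fun p => (∏ l, p l ^ a l) / ((q : ℝ) - ∏ l, p l) ^ m) (cube j) ∧ c = KZ.of r} ∪
        {c | ∃ (j : ℕ) (r : IntegralRep j) (a : Fin j → ℕ) (m : ℕ), j ≤ 2 ∧ r.domain = cube j ∧
          EqOn r.integrand (fun p => (∏ l, p l ^ a l) / ((1 - (q : ℝ)) - ∏ l, p l) ^ m) (cube j) ∧ c = KZ.of r} ∪
        {c | ∃ (r : IntegralRep 2) (a b m n : ℕ), r.domain = cube 2 ∧
          EqOn r.integrand (fun p => p 0 ^ a * p 1 ^ b / (((q : ℝ) - p 0) ^ m * ((q : ℝ) - p 1) ^ n)) (cube 2) ∧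
          c = KZ.of r}),
      KZ.eval c = 0 → c ∈ KZ.relations := by
  intro q hq
  have hq2 : 2 ≤ q := le_trans (by norm_num) hq
  refine stub_landenJoinKernel q hq2 fun a b c d h => ?_
  have hqR : (2 : ℝ) ≤ q := by exact_mod_cast hq2
  have I1 : (∫ p in cube 1, 1 / ((q : ℝ) - p 0)) =
      Literature.NumberTheory.DiophantineApproximation.DilogPade.polylogSeries 1 (1 / (q : ℝ)) := by
    rw [stub_cubeOneIntegralSeries q hq2, Literature.NumberTheory.DiophantineApproximation.DilogPade.polylogSeries]
    exact tsum_congr fun k => by rw [pow_one]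
  have I2 : (∫ p in cube 2, 1 / ((q : ℝ) - p 0 * p 1)) =
      Literature.NumberTheory.DiophantineApproximation.DilogPade.polylogSeries 2 (1 / (q : ℝ)) := by
    rw [stub_cubeTwoIntegralSeriesLevel (q : ℝ) hqR, Literature.NumberTheory.DiophantineApproximation.DilogPade.polylogSeries]
  have I2' : (∫ p in cube 2, 1 / ((1 - (q : ℝ)) - p 0 * p 1)) =
      Literature.NumberTheory.DiophantineApproximation.DilogPade.polylogSeries 2 (1 / (1 - (q : ℝ))) := by
    rw [stub_joinValueNegLevel q (le_trans (by norm_num) hq),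
      Literature.NumberTheory.DiophantineApproximation.DilogPade.polylogSeries]
  rw [I1, I2, I2'] at h
  exact hVZ.of_nine_le q hq a b c d h

end Assembly

end Summit.KontsevichZagierPeriods.HermiteRigidity.ReductionRigidity

end
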